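import Mathlib.RingTheory.RootsOfUnity.PrimitiveRoots
import Mathlib.RingTheory.IntegralClosure.IntegrallyClosed
import Mathlib.RingTheory.Polynomial.RationalRoot
import Mathlib.Algebra.Algebra.Rat
import Mathlib.Algebra.Ring.GeomSum
import Mathlib.Tactic.LinearCombination
import Mathlib.Tactic.IntervalCases
import Mathlib.Tactic.FieldSimp
import Mathlib.Tactic.Linarith
import HarnessLib

/-!
# Rational period ratios force a `d`-th root of `−1` (Villaflor, CCM 2022, Proposition 5.4)

R. Villaflor Loyola, *Small codimension components of the Hodge locus containing the Fermat variety*,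
Commun. Contemp. Math. 24 (2022) 2150053 = arXiv:2001.01019 [Villaflorloyola2021], §5 (held text, p. 12).
Verbatim:

> **Proposition 5.4.** Consider `d` such that `ζ_d + ζ_d^{−1} ∉ ℚ` (i.e. `d ≠ 1,2,3,4,6`). Suppose `a ∈ ℂ`
> satisfies that `(a^{d−1}+x)(ay−1) / ((a^{d−1}+y)(ax−1)) ∈ ℚ` (arthcond1) for all
> `x, y ∈ {ζ_{2d}, ζ_{2d}^3, ζ_{2d}^5, …, ζ_{2d}^{2d−1}}` such that (arthcond1) is well defined. Then `a^d + 1 = 0`.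
>
> *Proof.* Assume by contradiction that `a^d + 1 ≠ 0` […]. For such a pair we also have
> `(a^{d−1}+x)(ay−1)/((a^{d−1}+y)(ax−1)) − 1 = (a^d+1)(y−x)/((a^{d−1}+y)(ax−1)) ∈ ℚ^×`. Since `d ≥ 5` we
> can take `x_1, x_2, x_3, x_4 ∈ {ζ_{2d}, ζ_{2d}^3, …} ∖ {−a^{d−1}}` all different, then [the cross-ratio]
> `(x_1,x_2,x_3,x_4) := (x_1−x_2)(x_3−x_4)/((x_1−x_4)(x_3−x_2)) ∈ ℚ^×`. There exists some `i` such that we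
> can choose them of the form `x_1 = ζ_{2d}^{i+1}, x_2 = ζ_{2d}^{i+3}, x_3 = ζ_{2d}^{i+5}, x_4 = ζ_{2d}^{i+7}`
> and so `(x_1,x_2,x_3,x_4)^{−1} = […] = −1 − (ζ_d + ζ_d^{−1}) ∉ ℚ`. Contradicting our hypothesis on `d`. □

This is the arithmetic input of [Villaflorloyola2021] Thm. 1.2 (and so of Thm. 1.1, "only the loci of linear
cycles attain Movasati's bound"): in the proof of Thm. 1.2 (p. 12) the ratios `c_β/c_{β'}` of the periods of
the Hodge cycle `λ` over two linear cycles of the Fermat variety differing in one twist are exactly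
(arthcond1) with `x = ζ_{2d}^r`, `y = ζ_{2d}^s`; rationality of `λ` makes them rational, and `a^d = −1` says that
the line `x_{2i} = a x_{2i+1}` lies on `x_{2i}^d + x_{2i+1}^d = 0`.

## What this file PROVES (0 facts, 0 sorry), over any field `K` of characteristic `0`

* `order_mem_of_add_inv_eq_ratCast` — the parenthetical "(i.e. `d ≠ 1,2,3,4,6`)", in the direction used:
  a primitive `d`-th root of unity `w` (`d > 0`) with `w + w⁻¹ ∈ ℚ` has `d ∈ {1,2,3,4,6}`. Elementary proof
  (no Galois theory): `w + w⁻¹` is a rational algebraic integer, hence an integer `m` (tree pattern of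
  `Motives/AimedSplitProduct.lean`); the traces `u_k = w^k + w^{−k}` satisfy `u_{k+2} = m u_{k+1} − u_k`, so
  `|m| ≥ 3` forces `|u_k| ≥ k + 2`, contradicting `u_d = 2`; and `m ∈ {0, ±1, ±2}` gives `w² + 1 = m w`,
  whence `w^4 = 1`, `w^6 = 1`, `w^3 = 1`, or `w = ±1`.
* `pairSum e a c = Σ_{l<e} a^l c^{e−1−l}` (`·(a − c) = a^e − c^e`): the value at `x_{2j} = a y, x_{2j+1} = y` of the
  linear-cycle factor `(x_{2j}^e − (c x_{2j+1})^e)/(x_{2j} − c x_{2j+1})` of [DuqueFrancoVillaflor2025Join] Rem. 7.1 /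
  [Villaflorloyola2021] (5.2)–(5.3); `pairPeriod d a x = x · pairSum (d−1) a x`, the displayed
  `ζ^{α}(a^{d−1} − ζ^{α(d−1)})/(a − ζ^{α})` of the proof of Thm. 1.2; the division-free forms
  `(a − x)·pairPeriod d a x = a^{d−1}x + 1` (`sub_mul_pairPeriod`) and
  `(a − x)(a − y)(T(y) − T(x)) = (a^d + 1)(y − x)` (`key_identity`) of "(arthcond1) − 1 = (a^d+1)(y−x)/(…)".
* **`pow_eq_neg_one_of_forall_ratio_rational`** — Proposition 5.4 in the form the proof of Thm. 1.2 produces: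
  `5 ≤ d`, `d ≠ 6`, `ζ` a primitive `2d`-th root of unity, and `T(y)/T(x) ∈ ℚ` for all `x, y` with
  `x^d = y^d = −1`, `T(x) ≠ 0` ⟹ `a^d = −1`.
* **`villaflor_prop_5_4`** — Proposition 5.4 VERBATIM ((arthcond1) with its well-definedness condition).

The printed proof is followed (cross-ratio of four consecutive odd powers; "there exists some `i`" is made
explicit: start right after the zero of `T` on the odd powers, unique since `T` is injective there).
-/

namespace Literature.AlgebraicGeometry.Villaflor2022

open Finset

variable {K : Type*} [Field K]

/-! ## `ζ_d + ζ_d⁻¹ ∈ ℚ` only for `d ∈ {1,2,3,4,6}` -/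

/-- The integer sequence `u_0 = 2`, `u_1 = m`, `u_{k+2} = m·u_{k+1} − u_k` (the traces `w^k + w^{−k}` when
`w + w⁻¹ = m`). [folklore] -/
def traceSeq (m : ℤ) : ℕ → ℤ
  | 0 => 2
  | 1 => m
  | (k + 2) => m * traceSeq m (k + 1) - traceSeq m k

/-- `u_0 = 2`. [folklore] -/
@[simp] private theorem traceSeq_zero (m : ℤ) : traceSeq m 0 = 2 := rfl

/-- `u_1 = m`. [folklore] -/
@[simp] private theorem traceSeq_one (m : ℤ) : traceSeq m 1 = m := rfl

/-- The recursion. [folklore] -/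
private theorem traceSeq_add_two (m : ℤ) (k : ℕ) :
    traceSeq m (k + 2) = m * traceSeq m (k + 1) - traceSeq m k := rfl

/-- `u_k = w^k + w^{−k}` when `w + w⁻¹ = m`. [folklore] -/
private theorem cast_traceSeq_eq {w : K} (hw : w ≠ 0) {m : ℤ} (h : w + w⁻¹ = (m : K)) :
    ∀ k, (traceSeq m k : K) = w ^ k + w⁻¹ ^ k := by
  intro k
  induction k using Nat.twoStepInduction with
  | zero => simp; norm_num
  | one => simpa using h.symm
  | more k ih0 ih1 =>
    have hw' : w * w⁻¹ = 1 := mul_inv_cancel₀ hw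
    rw [traceSeq_add_two, Int.cast_sub, Int.cast_mul, ih0, ih1, ← h]
    linear_combination (w ^ k + w⁻¹ ^ k) * hw'

/-- If `|m| ≥ 3` the sequence `|u_k|` is strictly increasing. [folklore] -/
private theorem abs_traceSeq_lt_abs_traceSeq_succ {m : ℤ} (hm : 3 ≤ |m|) :
    ∀ k, |traceSeq m k| < |traceSeq m (k + 1)| := by
  intro k
  induction k with
  | zero =>
    rw [traceSeq_zero, traceSeq_one, abs_two]
    linarith
  | succ k ih =>
    rw [traceSeq_add_two]
    have h1 : |m| * |traceSeq m (k + 1)| - |traceSeq m k| ≤ |m * traceSeq m (k + 1) - traceSeq m k| := by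
      rw [← abs_mul]
      exact abs_sub_abs_le_abs_sub _ _
    have h2 : 3 * |traceSeq m (k + 1)| ≤ |m| * |traceSeq m (k + 1)| :=
      mul_le_mul_of_nonneg_right hm (abs_nonneg _)
    have h3 : 0 ≤ |traceSeq m k| := abs_nonneg _
    linarith

/-- Hence `|u_k| ≥ k + 2` when `|m| ≥ 3`. [folklore] -/
private theorem add_two_le_abs_traceSeq {m : ℤ} (hm : 3 ≤ |m|) (k : ℕ) : (k : ℤ) + 2 ≤ |traceSeq m k| := by
  induction k with
  | zero => simp
  | succ k ih =>
    have h := Int.lt_iff_add_one_le.mp (abs_traceSeq_lt_abs_traceSeq_succ hm k)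
    push_cast
    linarith

/-- **"`ζ_d + ζ_d^{−1} ∉ ℚ` (i.e. `d ≠ 1,2,3,4,6`)"**, the direction used: if a primitive `d`-th root of unity
`w` (`d > 0`) in a field of characteristic `0` has `w + w⁻¹` rational, then `d ∈ {1, 2, 3, 4, 6}`. Proof: `w + w⁻¹`
is an algebraic integer (`w`, `w⁻¹ = w^{d−1}` are) and rational, so an integer `m` (`ℤ` is integrally closed);
`|m| ≥ 3` is impossible because `u_k = w^k + w^{−k}` would grow while `u_d = 2`; and `m ∈ {0, ±1, ±2}` gives
`w² + 1 = m w`, whence `w^4 = 1`, `w^6 = 1`, `w^3 = 1` or `w = ±1`.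
[cite: Villaflorloyola2021, Theorem 1.1 (hypothesis), Proposition 5.4] -/
theorem order_mem_of_add_inv_eq_ratCast [CharZero K] {w : K} {d : ℕ} (hd : 0 < d)
    (hw : IsPrimitiveRoot w d) {q : ℚ} (h : w + w⁻¹ = (q : K)) :
    d = 1 ∨ d = 2 ∨ d = 3 ∨ d = 4 ∨ d = 6 := by
  have hw0 : w ≠ 0 := hw.ne_zero hd.ne'
  have hwd : w ^ d = 1 := hw.pow_eq_one
  -- `w + w⁻¹` is integral over `ℤ`, rational, hence an integer `m`
  have hint : IsIntegral ℤ w := IsIntegral.of_pow hd (by rw [hwd]; exact isIntegral_one)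
  have hinv : w⁻¹ = w ^ (d - 1) := by
    have : w ^ (d - 1) * w = 1 := by rw [← pow_succ, Nat.sub_add_cancel hd, hwd]
    exact (eq_inv_of_mul_eq_one_left this).symm
  have ht : IsIntegral ℤ (w + w⁻¹) := hint.add (by rw [hinv]; exact hint.pow _)
  have hq' : w + w⁻¹ = algebraMap ℚ K q := by rw [h, eq_ratCast]
  rw [hq'] at ht
  have hqint : IsIntegral ℤ q := (isIntegral_algebraMap_iff (algebraMap ℚ K).injective).1 ht
  obtain ⟨m, hm⟩ := IsIntegrallyClosed.isIntegral_iff.1 hqint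
  have hmq : (m : ℚ) = q := by simpa using hm
  have hmK : w + w⁻¹ = (m : K) := by rw [h, ← hmq, Rat.cast_intCast]
  -- `|m| ≤ 2`
  have hm2 : |m| ≤ 2 := by
    by_contra H
    have H' : 3 ≤ |m| := by
      have := le_or_gt 3 |m|
      rcases this with h3 | h3
      · exact h3
      · exfalso; exact H (by linarith [Int.lt_iff_add_one_le.mp h3])
    have h1 := add_two_le_abs_traceSeq H' d
    have h2 : (traceSeq m d : K) = 2 := by
      rw [cast_traceSeq_eq hw0 hmK d, inv_pow, hwd, inv_one]; norm_num
    have h3 : traceSeq m d = 2 := by exact_mod_cast h2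
    rw [h3, abs_two] at h1
    have : (0 : ℤ) < d := by exact_mod_cast hd
    linarith
  -- `w² + 1 = m w`
  have hrel : w ^ 2 + 1 = (m : K) * w := by
    rw [← hmK]; field_simp
  have hcases : m = -2 ∨ m = -1 ∨ m = 0 ∨ m = 1 ∨ m = 2 := by
    rw [abs_le] at hm2; omega
  have hdvd : ∀ k : ℕ, w ^ k = 1 → d ∣ k := fun k hk => hw.dvd_of_pow_eq_one k hk
  rcases hcases with rfl | rfl | rfl | rfl | rfl
  · -- `m = −2`: `(w + 1)² = 0`, `w = −1`, `w² = 1`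
    push_cast at hrel
    have h1 : (w + 1) ^ 2 = 0 := by linear_combination hrel
    have h2 : w + 1 = 0 := pow_eq_zero_iff (two_ne_zero) |>.mp h1
    have h3 : d ∣ 2 := hdvd 2 (by rw [show w = -1 by linear_combination h2]; norm_num)
    have : d ≤ 2 := Nat.le_of_dvd (by norm_num) h3
    interval_cases d <;> omega
  · -- `m = −1`: `w² + w + 1 = 0`, `w³ = 1`
    push_cast at hrel
    have h1 : w ^ 3 = 1 := by linear_combination (w - 1) * hrel
    have h3 : d ∣ 3 := hdvd 3 h1
    have : d ≤ 3 := Nat.le_of_dvd (by norm_num) h3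
    interval_cases d <;> omega
  · -- `m = 0`: `w² = −1`, `w⁴ = 1`
    push_cast at hrel
    have h1 : w ^ 4 = 1 := by linear_combination (w ^ 2 - 1) * hrel
    have h3 : d ∣ 4 := hdvd 4 h1
    have : d ≤ 4 := Nat.le_of_dvd (by norm_num) h3
    interval_cases d <;> omega
  · -- `m = 1`: `w² − w + 1 = 0`, `w⁶ = 1`
    push_cast at hrel
    have h1 : w ^ 6 = 1 := by linear_combination (w ^ 4 + w ^ 3 - w - 1) * hrel
    have h3 : d ∣ 6 := hdvd 6 h1
    have : d ≤ 6 := Nat.le_of_dvd (by norm_num) h3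
    interval_cases d <;> omega
  · -- `m = 2`: `(w − 1)² = 0`, `w = 1`
    push_cast at hrel
    have h1 : (w - 1) ^ 2 = 0 := by linear_combination hrel
    have h2 : w - 1 = 0 := pow_eq_zero_iff (two_ne_zero) |>.mp h1
    have h3 : d ∣ 1 := hdvd 1 (by rw [show w = 1 by linear_combination h2]; norm_num)
    have : d ≤ 1 := Nat.le_of_dvd (by norm_num) h3
    interval_cases d; omega

/-- The form in which the cross-ratio argument ends: `w + w⁻¹ ∈ ℚ` is impossible for a primitive `d`-th root
of unity with `5 ≤ d`, `d ≠ 6`. [cite: Villaflorloyola2021, Proposition 5.4 (proof)] -/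
theorem add_inv_ne_ratCast [CharZero K] {w : K} {d : ℕ} (hd : 5 ≤ d) (hd6 : d ≠ 6)
    (hw : IsPrimitiveRoot w d) (q : ℚ) : w + w⁻¹ ≠ (q : K) := by
  intro h
  rcases order_mem_of_add_inv_eq_ratCast (by omega) hw h with h1 | h1 | h1 | h1 | h1 <;> omega

/-- A primitive `2d`-th root of unity `ζ` has `ζ^d = −1` (so the odd powers of `ζ` are `d`-th roots of `−1`).
[cite: Villaflorloyola2021, Proposition 5.2 (the twists `ζ_{2d}^{α}`, `α` odd)] -/
theorem pow_eq_neg_one_of_isPrimitiveRoot_two_mul {ζ : K} {d : ℕ} (hd : 0 < d)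
    (hζ : IsPrimitiveRoot ζ (2 * d)) : ζ ^ d = -1 := by
  have h := hζ.pow_of_dvd hd.ne' (Dvd.intro_left 2 rfl)
  rw [Nat.mul_div_cancel _ hd] at h
  exact h.eq_neg_one_of_two_right

/-- … and `ζ²` is a primitive `d`-th root of unity (`ζ_{2d}² = ζ_d`).
[cite: Villaflorloyola2021, Proposition 5.4 (proof)] -/
theorem isPrimitiveRoot_sq_of_isPrimitiveRoot_two_mul {ζ : K} {d : ℕ} (hζ : IsPrimitiveRoot ζ (2 * d)) :
    IsPrimitiveRoot (ζ ^ 2) d := by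
  have h := hζ.pow_of_dvd two_ne_zero (Dvd.intro d rfl)
  rwa [Nat.mul_div_cancel_left _ (by norm_num : 0 < 2)] at h

/-! ## The twisted factor value and the identity behind (arthcond1) -/

/-- `pairSum e a c = Σ_{l<e} a^l c^{e−1−l}` — the value at `x_{2j} = a y`, `x_{2j+1} = y` (coefficient of `y^{e−1}`) of
the `0`-dimensional factor `(x_{2j}^e − (c x_{2j+1})^e)/(x_{2j} − c x_{2j+1}) = Σ_{l<e} x_{2j}^l (c x_{2j+1})^{e−1−l}`:
the bracket `(a_{2j−2}^{d−1} − (ζ_{2d}^{α})^{d−1})/(a_{2j−2} − ζ_{2d}^{α})` of the proof of Thm. 1.2, `e = d − 1`,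
`c = ζ_{2d}^{α}`. [cite: Villaflorloyola2021, §5, proof of Theorem 1.2] [cite: DuqueFrancoVillaflor2025Join, Remark 7.1] -/
def pairSum (e : ℕ) (a c : K) : K := ∑ l ∈ range e, a ^ l * c ^ (e - 1 - l)

/-- `pairSum e a c · (a − c) = a^e − c^e`. [cite: Villaflorloyola2021, §5, proof of Theorem 1.2] -/
theorem pairSum_mul_sub (e : ℕ) (a c : K) : pairSum e a c * (a - c) = a ^ e - c ^ e :=
  geom_sum₂_mul a c e

/-- At `c = a`: `pairSum e a a = e·a^{e−1}` (the bracket `(a^{d−1} − x^{d−1})/(a − x)` of the proof of Thm. 1.2 at a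
twist `x = a`, read as the derivative). [cite: Villaflorloyola2021, §5, proof of Theorem 1.2] -/
theorem pairSum_self (e : ℕ) (a : K) : pairSum e a a = e * a ^ (e - 1) := by
  unfold pairSum
  have : ∀ l ∈ range e, a ^ l * a ^ (e - 1 - l) = a ^ (e - 1) := by
    intro l hl
    rw [mem_range] at hl
    rw [← pow_add, show l + (e - 1 - l) = e - 1 by omega]
  rw [sum_congr rfl this, sum_const, card_range, nsmul_eq_mul]

/-- `pairSum e 0 c = c^{e−1}` (`e ≥ 1`): the bracket of the proof of Thm. 1.2 for `a_{2i−2} = 0` (a coordinate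
hyperplane `x_{2i−2} = 0`). [cite: Villaflorloyola2021, §5, proof of Theorem 1.2] -/
theorem pairSum_zero_left {e : ℕ} (he : 1 ≤ e) (c : K) : pairSum e 0 c = c ^ (e - 1) := by
  unfold pairSum
  rw [sum_eq_single_of_mem 0 (mem_range.mpr (by omega))]
  · simp
  · intro l _ hl0
    rw [zero_pow hl0, zero_mul]

/-- `pairPeriod d a x = x · Σ_{l<d−1} a^l x^{d−2−l}`: Villaflor's `ζ^{α}·(a^{d−1} − ζ^{α(d−1)})/(a − ζ^{α})` for
`x = ζ^{α}` — up to the common factor `c_λ c_δ ∏_{j ≠ i}(…)`, the period `c_β` of the class over the linear cycle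
whose `i`-th twist is `x`. [cite: Villaflorloyola2021, §5, proof of Theorem 1.2] -/
def pairPeriod (d : ℕ) (a x : K) : K := x * pairSum (d - 1) a x

/-- **Division-free form of (arthcond1)'s numerator**: for `x^d = −1` (`d ≥ 1`),
`(a − x) · pairPeriod d a x = a^{d−1} x + 1`, i.e. `pairPeriod d a x = (a^{d−1}x + 1)/(a − x)` for `x ≠ a`
(`ζ^{α(d−1)} = −ζ^{−α}` for odd `α`). [cite: Villaflorloyola2021, §5, proof of Theorem 1.2] -/
theorem sub_mul_pairPeriod {d : ℕ} (hd : 1 ≤ d) (a : K) {x : K} (hx : x ^ d = -1) :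
    (a - x) * pairPeriod d a x = a ^ (d - 1) * x + 1 := by
  have h := pairSum_mul_sub (d - 1) a x
  have hxd : x ^ (d - 1) * x = -1 := by rw [← pow_succ, Nat.sub_add_cancel hd, hx]
  unfold pairPeriod
  linear_combination x * h - hxd

/-- **The identity of the printed proof** ("`(arthcond1) − 1 = (a^d+1)(y−x)/((a^{d−1}+y)(ax−1))`"), division-free:
for `x^d = y^d = −1`, `(a − x)(a − y)(T(y) − T(x)) = (a^d + 1)(y − x)`, `T = pairPeriod d a`.
[cite: Villaflorloyola2021, Proposition 5.4 (proof)] -/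
theorem key_identity {d : ℕ} (hd : 1 ≤ d) (a : K) {x y : K} (hx : x ^ d = -1) (hy : y ^ d = -1) :
    (a - x) * (a - y) * (pairPeriod d a y - pairPeriod d a x) = (a ^ d + 1) * (y - x) := by
  have h1 := sub_mul_pairPeriod hd a hx
  have h2 := sub_mul_pairPeriod hd a hy
  have ha : a ^ d = a * a ^ (d - 1) := by rw [← pow_succ', Nat.sub_add_cancel hd]
  linear_combination (a - x) * h2 - (a - y) * h1 + (x - y) * ha

/-! ## Proposition 5.4 -/

/-- **Villaflor, Proposition 5.4 (ratio form, as produced by the proof of Theorem 1.2).** Let `5 ≤ d`, `d ≠ 6`,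
`ζ` a primitive `2d`-th root of unity in a field of characteristic `0`, `a ∈ K`, `T = pairPeriod d a`
(`T(x) = (a^{d−1}x+1)/(a−x)` on `x^d = −1`). If for all `x, y` with `x^d = y^d = −1` and `T(x) ≠ 0` the ratio
`T(y)/T(x)` is rational, then `a^d = −1`. Proof as printed: otherwise `T` is injective on the `d`-th roots of `−1`
(`key_identity`), so it vanishes at most once there; the four consecutive points `x_j = x_0 ζ^{2j}`, `j = 1..4`, after
that zero have `T(x_j) = q_j T(x_1) ≠ 0`, `q_j ∈ ℚ`; their cross-ratio is `(1−q_2)(q_3−q_4)/((1−q_4)(q_3−q_2)) ∈ ℚ` and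
equals `−ζ²/(1+ζ²+ζ⁴)`, whence `ζ² + ζ^{−2} ∈ ℚ`, contradicting `order_mem_of_add_inv_eq_ratCast`.
[cite: Villaflorloyola2021, Proposition 5.4] -/
theorem pow_eq_neg_one_of_forall_ratio_rational [CharZero K] {d : ℕ} (hd : 5 ≤ d) (hd6 : d ≠ 6) {ζ : K}
    (hζ : IsPrimitiveRoot ζ (2 * d)) (a : K)
    (hrat : ∀ x y : K, x ^ d = -1 → y ^ d = -1 → pairPeriod d a x ≠ 0 →
      ∃ q : ℚ, pairPeriod d a y = (q : K) * pairPeriod d a x) :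
    a ^ d = -1 := by
  by_contra hne
  have hd1 : 1 ≤ d := by omega
  have hD : a ^ d + 1 ≠ 0 := fun h => hne (by linear_combination h)
  -- roots of unity
  obtain ⟨w, hw_def⟩ : ∃ w : K, w = ζ ^ 2 := ⟨_, rfl⟩
  have hw : IsPrimitiveRoot w d := hw_def ▸ isPrimitiveRoot_sq_of_isPrimitiveRoot_two_mul hζ
  have hζd : ζ ^ d = -1 := pow_eq_neg_one_of_isPrimitiveRoot_two_mul (by omega) hζ
  have hwd : w ^ d = 1 := hw.pow_eq_one
  have hw0 : w ≠ 0 := hw.ne_zero (by omega)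
  have hwj : ∀ j : ℕ, 1 ≤ j → j ≤ 4 → w ^ j ≠ 1 := by
    intro j hj1 hj4 h
    have := Nat.le_of_dvd (by omega) (hw.dvd_of_pow_eq_one j h)
    omega
  have hμ : ∀ {x : K}, x ^ d = -1 → ∀ j : ℕ, (x * w ^ j) ^ d = -1 := by
    intro x hx j
    have : (w ^ j) ^ d = 1 := by rw [← pow_mul, mul_comm, pow_mul, hwd, one_pow]
    rw [mul_pow, this, mul_one, hx]
  have hx0 : ∀ {x : K}, x ^ d = -1 → x ≠ 0 := by
    intro x hx h0
    rw [h0, zero_pow (by omega)] at hx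
    norm_num at hx
  -- injectivity of `T` on the `d`-th roots of `−1`
  have hinj : ∀ {x y : K}, x ^ d = -1 → y ^ d = -1 → pairPeriod d a x = pairPeriod d a y → x = y := by
    intro x y hx hy hxy
    have h := key_identity hd1 a hx hy
    rw [hxy, sub_self, mul_zero] at h
    rcases mul_eq_zero.mp h.symm with h1 | h1
    · exact absurd h1 hD
    · linear_combination -h1
  -- a base point `x₀` after which four consecutive points are non-zeros of `T`
  obtain ⟨x₀, hx₀, hgood⟩ : ∃ x₀ : K, x₀ ^ d = -1 ∧
      ∀ j : ℕ, 1 ≤ j → j ≤ 4 → pairPeriod d a (x₀ * w ^ j) ≠ 0 := by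
    by_cases hz : ∃ x : K, x ^ d = -1 ∧ pairPeriod d a x = 0
    · obtain ⟨xb, hxb, hTb⟩ := hz
      refine ⟨xb, hxb, fun j hj1 hj4 h => hwj j hj1 hj4 ?_⟩
      have heq := hinj hxb (hμ hxb j) (hTb.trans h.symm)
      have h1 : xb * (w ^ j - 1) = 0 := by linear_combination -heq
      rcases mul_eq_zero.mp h1 with h2 | h2
      · exact absurd h2 (hx0 hxb)
      · linear_combination h2
    · push Not at hz
      exact ⟨ζ, hζd, fun j _ _ => hz _ (hμ hζd j)⟩
  -- the points `x_j = x₀ w^j` and the values `t_j = T(x_j)`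
  obtain ⟨x, hx⟩ : ∃ x : ℕ → K, ∀ j, x j = x₀ * w ^ j := ⟨fun j => x₀ * w ^ j, fun j => rfl⟩
  have hμj : ∀ j : ℕ, x j ^ d = -1 := fun j => by rw [hx]; exact hμ hx₀ j
  obtain ⟨t, ht⟩ : ∃ t : ℕ → K, ∀ j, t j = pairPeriod d a (x j) :=
    ⟨fun j => pairPeriod d a (x j), fun j => rfl⟩
  have ht0 : ∀ j : ℕ, 1 ≤ j → j ≤ 4 → t j ≠ 0 := fun j hj1 hj4 => by
    rw [ht, hx]; exact hgood j hj1 hj4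
  have ht1 : t 1 ≠ 0 := ht0 1 le_rfl (by norm_num)
  have hq : ∀ j : ℕ, ∃ q : ℚ, t j = (q : K) * t 1 := fun j => by
    obtain ⟨q, hq⟩ := hrat (x 1) (x j) (hμj 1) (hμj j) (by rw [← ht]; exact ht1)
    exact ⟨q, by rw [ht, ht, hq]⟩
  obtain ⟨q2, hq2⟩ := hq 2
  obtain ⟨q3, hq3⟩ := hq 3
  obtain ⟨q4, hq4⟩ := hq 4
  -- the key identity for all pairs of points
  have kij : ∀ i j : ℕ, (a - x i) * (a - x j) * (t j - t i) = (a ^ d + 1) * (x j - x i) := fun i j => by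
    rw [ht, ht]; exact key_identity hd1 a (hμj i) (hμj j)
  -- distinct points have distinct values (injectivity): `q_2 ≠ 1`, `q_3 ≠ q_4`
  have hdist : ∀ i j : ℕ, i < j → j ≤ i + 3 → t i ≠ t j := by
    intro i j hij hj h
    have heq := hinj (hμj i) (hμj j) (by rw [← ht, ← ht, h])
    have h1 : x₀ * w ^ i * (w ^ (j - i) - 1) = 0 := by
      have : x₀ * w ^ j = x₀ * w ^ i * w ^ (j - i) := by
        rw [mul_assoc, ← pow_add, Nat.add_sub_cancel' hij.le]
      rw [hx, hx] at heq
      linear_combination -heq - this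
    rcases mul_eq_zero.mp h1 with h2 | h2
    · rcases mul_eq_zero.mp h2 with h3 | h3
      · exact hx0 hx₀ h3
      · exact pow_ne_zero i hw0 h3
    · exact hwj (j - i) (by omega) (by omega) (by linear_combination h2)
  have hq2ne : (q2 : K) ≠ 1 := by
    intro h
    exact hdist 1 2 (by norm_num) (by norm_num) (by rw [hq2, h, one_mul])
  have hq34 : (q3 : K) ≠ q4 := by
    intro h
    exact hdist 3 4 (by norm_num) (by norm_num) (by rw [hq3, hq4, h])
  -- the cross-ratio identity `(x1−x2)(x3−x4)(t1−t4)(t3−t2) = (x1−x4)(x3−x2)(t1−t2)(t3−t4)`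
  set D : K := a ^ d + 1 with hD_def
  have e1 : D ^ 2 * ((x 1 - x 2) * (x 3 - x 4)) =
      (a - x 1) * (a - x 2) * (a - x 3) * (a - x 4) * ((t 1 - t 2) * (t 3 - t 4)) := by
    linear_combination (-((a - x 4) * (a - x 3) * (t 3 - t 4))) * kij 2 1 + (-(D * (x 1 - x 2))) * kij 4 3
  have e2 : D ^ 2 * ((x 1 - x 4) * (x 3 - x 2)) =
      (a - x 1) * (a - x 2) * (a - x 3) * (a - x 4) * ((t 1 - t 4) * (t 3 - t 2)) := by
    linear_combination (-((a - x 2) * (a - x 3) * (t 3 - t 2))) * kij 4 1 + (-(D * (x 1 - x 4))) * kij 2 3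
  have hI0 : D ^ 2 * ((x 1 - x 2) * (x 3 - x 4) * (t 1 - t 4) * (t 3 - t 2) -
      (x 1 - x 4) * (x 3 - x 2) * (t 1 - t 2) * (t 3 - t 4)) = 0 := by
    linear_combination (t 1 - t 4) * (t 3 - t 2) * e1 - (t 1 - t 2) * (t 3 - t 4) * e2
  have hI : (x 1 - x 2) * (x 3 - x 4) * (t 1 - t 4) * (t 3 - t 2) =
      (x 1 - x 4) * (x 3 - x 2) * (t 1 - t 2) * (t 3 - t 4) := by
    rcases mul_eq_zero.mp hI0 with h | h
    · exact absurd (pow_eq_zero_iff (by norm_num) |>.mp h) hD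
    · linear_combination h
  -- substitute `x_j = x₀ w^j`, `t_j = q_j t_1`
  set α : ℚ := (1 - q4) * (q3 - q2) with hα
  set β : ℚ := (1 - q2) * (q3 - q4) with hβ
  have hβ0 : (β : K) ≠ 0 := by
    rw [hβ]; push_cast
    exact mul_ne_zero (sub_ne_zero.mpr (Ne.symm hq2ne)) (sub_ne_zero.mpr hq34)
  have hrel : x₀ ^ 2 * w ^ 3 * t 1 ^ 2 * (1 - w) ^ 2 * (w * α + (1 + w + w ^ 2) * β) = 0 := by
    rw [hα, hβ]; push_cast
    rw [hq2, hq3, hq4] at hI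
    simp only [hx] at hI
    linear_combination hI
  have h1w : (1 - w) ≠ 0 := by
    intro h
    exact hwj 1 le_rfl (by norm_num) (by linear_combination -h)
  have hcore : w * α + (1 + w + w ^ 2) * β = 0 := by
    have hnz : x₀ ^ 2 * w ^ 3 * t 1 ^ 2 * (1 - w) ^ 2 ≠ 0 :=
      mul_ne_zero (mul_ne_zero (mul_ne_zero (pow_ne_zero _ (hx0 hx₀)) (pow_ne_zero _ hw0))
        (pow_ne_zero _ ht1)) (pow_ne_zero _ h1w)
    exact (mul_eq_zero.mp hrel).resolve_left hnz
  -- `w + w⁻¹ = −(α+β)/β ∈ ℚ`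
  have hfin : w + w⁻¹ = ((-(α + β) / β : ℚ) : K) := by
    push_cast
    field_simp
    linear_combination hcore
  exact add_inv_ne_ratCast hd hd6 hw _ hfin

/-- **Villaflor, Proposition 5.4 — verbatim.** "Consider `d` such that `ζ_d + ζ_d^{−1} ∉ ℚ` (i.e. `d ≠ 1,2,3,4,6`).
Suppose `a ∈ ℂ` satisfies that `(a^{d−1}+x)(ay−1)/((a^{d−1}+y)(ax−1)) ∈ ℚ` for all
`x, y ∈ {ζ_{2d}, ζ_{2d}^3, …, ζ_{2d}^{2d−1}}` such that [it] is well defined. Then `a^d + 1 = 0`." Here over any field of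
characteristic `0` with a primitive `2d`-th root of unity `ζ`, for `d ≥ 5`, `d ≠ 6` (the content of the parenthetical
for `d ≥ 3`); the odd powers of `ζ_{2d}` are the `x` with `x^d = −1`; "well defined" = the printed denominator is
non-zero. Reduced to `pow_eq_neg_one_of_forall_ratio_rational` by `x ↦ x⁻¹`, `y ↦ y⁻¹`:
`T(y)/T(x) = (a^{d−1}+y⁻¹)(ax⁻¹−1)/((a^{d−1}+x⁻¹)(ay⁻¹−1))`. [cite: Villaflorloyola2021, Proposition 5.4] -/
theorem villaflor_prop_5_4 [CharZero K] {d : ℕ} (hd : 5 ≤ d) (hd6 : d ≠ 6) {ζ : K}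
    (hζ : IsPrimitiveRoot ζ (2 * d)) (a : K)
    (h : ∀ x y : K, x ^ d = -1 → y ^ d = -1 → (a ^ (d - 1) + y) * (a * x - 1) ≠ 0 →
      ∃ q : ℚ, (a ^ (d - 1) + x) * (a * y - 1) = (q : K) * ((a ^ (d - 1) + y) * (a * x - 1))) :
    a ^ d + 1 = 0 := by
  by_cases hne : a ^ d = -1
  · rw [hne]; ring
  exfalso
  refine hne (pow_eq_neg_one_of_forall_ratio_rational hd hd6 hζ a fun x y hx hy hTx => ?_)
  have hd1 : 1 ≤ d := by omega
  have hx0 : x ≠ 0 := by intro h0; rw [h0, zero_pow (by omega)] at hx; norm_num at hx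
  have hy0 : y ≠ 0 := by intro h0; rw [h0, zero_pow (by omega)] at hy; norm_num at hy
  have hxi : x⁻¹ ^ d = -1 := by rw [inv_pow, hx]; norm_num
  have hyi : y⁻¹ ^ d = -1 := by rw [inv_pow, hy]; norm_num
  have hax : a - x ≠ 0 := by
    intro h0; apply hne; rw [show a = x by linear_combination h0, hx]
  have hay : a - y ≠ 0 := by
    intro h0; apply hne; rw [show a = y by linear_combination h0, hy]
  have eTx := sub_mul_pairPeriod hd1 a hx
  have eTy := sub_mul_pairPeriod hd1 a hy
  -- `a^{d−1} + x⁻¹ = x⁻¹ (a − x) T(x)`, `a y⁻¹ − 1 = y⁻¹ (a − y)`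
  have f1 : a ^ (d - 1) + x⁻¹ = x⁻¹ * ((a - x) * pairPeriod d a x) := by
    rw [eTx]; field_simp
  have f2 : a ^ (d - 1) + y⁻¹ = y⁻¹ * ((a - y) * pairPeriod d a y) := by
    rw [eTy]; field_simp
  have f3 : a * y⁻¹ - 1 = y⁻¹ * (a - y) := by field_simp
  have f4 : a * x⁻¹ - 1 = x⁻¹ * (a - x) := by field_simp
  have hwd : (a ^ (d - 1) + x⁻¹) * (a * y⁻¹ - 1) ≠ 0 := by
    rw [f1, f3]
    exact mul_ne_zero (mul_ne_zero (inv_ne_zero hx0) (mul_ne_zero hax hTx))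
      (mul_ne_zero (inv_ne_zero hy0) hay)
  obtain ⟨q, hq⟩ := h y⁻¹ x⁻¹ hyi hxi hwd
  refine ⟨q, ?_⟩
  rw [f1, f2, f3, f4] at hq
  have hc : x⁻¹ * y⁻¹ * (a - y) * (a - x) ≠ 0 :=
    mul_ne_zero (mul_ne_zero (mul_ne_zero (inv_ne_zero hx0) (inv_ne_zero hy0)) hay) hax
  have : x⁻¹ * y⁻¹ * (a - y) * (a - x) * (pairPeriod d a y - q * pairPeriod d a x) = 0 := by
    linear_combination hq
  have := (mul_eq_zero.mp this).resolve_left hc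
  linear_combination this

end Literature.AlgebraicGeometry.Villaflor2022
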